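import Literature.MathematicalPhysics.QuantumFieldTheory.Balaban1983to89.T4OutputRate
import Summits.QuantumFields.YangMills.Theorems.BalabanUVNodesN18Knit

/-!
# BalabanUVNodes ∕ N18 — the U3 bundle on the DRESSED carriers of record `Dom := Dom₀ ⊕ (Dom₀ × T)`: node N18's
# statement there IS «vacuum NE5 ∧ dressed NE5 UNIFORMLY in t at the SAME letters» (and likewise NE9, the Lipschitz-in-U
# bracket and the one-run envelopes) — the plan's design word [YMPLAN-G61-WORD-U3-DRESSED] in kernel form (Track A, DAG
# node N18 = NE5 `T4OutputRate.NE5 EA EB W κ θ C₅` :211; cluster K4; located typing point, count-neutral)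

HONEST FRAMING.  Count-neutral kernel bookkeeping over the HYPOTHESIS SHAPES of `T4OutputRate` (seat pub-ymgap-dag-n18-a
g4; `--supports stmt-QuantumFields-19182`).  Nothing of Bałaban's one-step outputs `E^{(j)}(X; g, U)` or dressed pieces
`D_t(X; g, U)` is asserted: NE5 ∕ NE9 are NOT IN PRINT ([Balaban1987RG1] Thm 1 p. 259 has only the uniformity in ε); NOT a
node discharge; one finite torus; nothing continuum ∕ ℝ⁴ ∕ OS ∕ mass-gap ∕ Clay.  THEOREMS ONLY: 0 `def`, 0 `sorry`.

THE POINT.  The plan ruled (pub-ymgap INBOX l.10200, 2026-08-26, recorded in the dagwriter's module 2 v2 `U3Carriers`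
docstring): the U3 «carriers of record» INCLUDE the observable-attached (dressed) domains — `Dom := Dom₀ ⊕ (Dom₀ × T)`
(`T` = the source letters on the compact window), `scale (X,t) := scale X`, `d (X,t) := d X`, `EA g U (X,t) := D_t(X; g, U)`,
vacuum indices as before — «whence `N18At` ∕ `N22At` (`∀ X : C.Dom`) STATE the dressed two-run rates at the SAME letters
with `C₅`, `Λ` UNIFORM in `t` on the source window — a prover's burden inside N18 ∕ N22, no new node shape, no dressed
twin».  This file is that sentence as kernel-checked EQUIVALENCES over `T4OutputRate.Carriers` (the dressed carriers
written as the structure-update LITERAL `{ C with Dom := C.Dom ⊕ (C.Dom × T), … }` — no new object is defined; the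
instancer's `RRec` remains NODE 00's ∕ def-T's to type):
* `decayBound_dressed_iff` — the one-run envelope (0.25) on the dressed carriers ⇔ vacuum envelope ∧ `∀ t` dressed
  envelope, same `E₀, κ`;
* **`ne5_dressed_iff`** — N18's decl on the dressed carriers ⇔ `NE5 EA EB W κ θ C₅ ∧ ∀ t, NE5 (DA t) (DB t) W κ θ C₅`
  (SAME `κ, θ, C₅` for every `t`: the uniformity-in-`t` burden, exactly);
* `ne9_dressed_iff`, `lipBackground_dressed_iff` — the sibling brackets of node U3 (`u3_threeBrackets`) likewise, same
  history moduli `Λ` ∕ same constant family `CU`;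
* `ne5_dressed_of_family` — the prover's road: vacuum `NE5 … C₀` and per-source `NE5 (DA t) (DB t) … (c t)` with
  `c t ≤ C₁` on the window give the dressed-carrier `NE5 … (max C₀ C₁)` (`N18Knit.ne5_mono`);
* `ne5_vacuum_of_dressed`, `ne5_source_of_dressed` — the two pull-backs (`N18Knit.ne5_comap` along `Sum.inl`,
  `X ↦ Sum.inr (X, t)`), so nothing is lost by stating the node on the dressed carriers.
Sources: T. Bałaban, Commun. Math. Phys. **109** (1987) 249–301 [Balaban1987RG1], (0.24)–(0.25) p. 257, Thm 1 p. 259;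
Commun. Math. Phys. **119** (1988) 243–285 [Balaban1988Convergent], (2.27) p. 259 and (2.43) p. 263 (the dressed pieces
and their sizes).  No claim about the mass gap.
-/

namespace Summit.QuantumFields.YangMills.BalabanUVNodes.N18DressedCarriers

open Literature.MathematicalPhysics.QuantumFieldTheory.Balaban1983to89.T4OutputRate
open Summit.QuantumFields.YangMills.BalabanUVNodes.N18Knit (ne5_mono ne5_comap)

variable {C : Carriers} {T : Type}

/-! ## §1 One-run envelopes and N18's decl on the dressed carriers: pointwise in the domain, hence a conjunction -/

/-- The one-run envelope (0.25) ∕ (1.18) on the dressed carriers `Dom₀ ⊕ (Dom₀ × T)` (vacuum terms on `inl X`, dressed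
pieces `D_t` on `inr (X, t)`, same scale and tree length) is EQUIVALENT to: the vacuum envelope and, for every source
letter `t`, the dressed envelope — with the SAME `E₀, κ`. [cite: Balaban1987RG1, (0.25) p.257; Balaban1988Convergent, (2.43) p.263] -/
theorem decayBound_dressed_iff {Bg : Type} (E : Functional C Bg) (D : T → Functional C Bg) {W : Set (ℕ → ℝ)}
    {E₀ κ : ℝ} :
    DecayBound (C := { C with
          Dom := C.Dom ⊕ (C.Dom × T)
          scale := Sum.elim C.scale fun p => C.scale p.1
          d := Sum.elim C.d fun p => C.d p.1
          d_nonneg := Sum.rec (fun X => C.d_nonneg X) fun p => C.d_nonneg p.1 })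
        (fun g U X => Sum.elim (E g U) (fun p => D p.2 g U p.1) X) W E₀ κ
      ↔ DecayBound E W E₀ κ ∧ ∀ t, DecayBound (D t) W E₀ κ := by
  constructor
  · intro h
    exact ⟨fun g hg U X => h g hg U (Sum.inl X), fun t g hg U X => h g hg U (Sum.inr (X, t))⟩
  · rintro ⟨h0, h1⟩ g hg U (X | ⟨X, t⟩)
    · exact h0 g hg U X
    · exact h1 t g hg U X

/-- **N18's DECL OF RECORD ON THE DRESSED CARRIERS OF RECORD = VACUUM `NE5` ∧ DRESSED `NE5` UNIFORMLY IN THE SOURCE.**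
With `Dom := Dom₀ ⊕ (Dom₀ × T)`, `scale (X,t) := scale X`, `d (X,t) := d X`, backgrounds ∕ gauge ∕ transport unchanged,
run A reading `EA` on vacuum indices and `DA t` on dressed ones (run B likewise):
`NE5 … W κ θ C₅` on the dressed carriers ⇔ `NE5 EA EB W κ θ C₅ ∧ ∀ t, NE5 (DA t) (DB t) W κ θ C₅` — the SAME `κ, θ, C₅`
for every `t` (the plan's «constants uniform in t on the source window», exactly). [cite: Balaban1987RG1, Thm 1 p.259] -/
theorem ne5_dressed_iff (EA : Functional C C.BgA) (EB : Functional C C.BgB) (DA : T → Functional C C.BgA)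
    (DB : T → Functional C C.BgB) {W : Set (ℕ → ℝ)} {κ θ C₅ : ℝ} :
    NE5 (C := { C with
          Dom := C.Dom ⊕ (C.Dom × T)
          scale := Sum.elim C.scale fun p => C.scale p.1
          d := Sum.elim C.d fun p => C.d p.1
          d_nonneg := Sum.rec (fun X => C.d_nonneg X) fun p => C.d_nonneg p.1 })
        (fun g U X => Sum.elim (EA g U) (fun p => DA p.2 g U p.1) X)
        (fun g U X => Sum.elim (EB g U) (fun p => DB p.2 g U p.1) X) W κ θ C₅
      ↔ NE5 EA EB W κ θ C₅ ∧ ∀ t, NE5 (DA t) (DB t) W κ θ C₅ := by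
  constructor
  · intro h
    exact ⟨fun g hg U X => h g hg U (Sum.inl X), fun t g hg U X => h g hg U (Sum.inr (X, t))⟩
  · rintro ⟨h0, h1⟩ g hg U (X | ⟨X, t⟩)
    · exact h0 g hg U X
    · exact h1 t g hg U X

/-! ## §2 The sibling brackets of node U3 (`u3_threeBrackets`) on the dressed carriers -/

/-- NE9 (joint Lipschitz dependence on the preceding couplings, history moduli `Λ`) on the dressed carriers ⇔ vacuum NE9
∧ `∀ t` dressed NE9, with the SAME `Λ` (N22's «`Λ` uniform in t»). [cite: Balaban1987RG1, §1 p.263 and §5 p.298] -/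
theorem ne9_dressed_iff {Bg : Type} (E : Functional C Bg) (D : T → Functional C Bg) {W : Set (ℕ → ℝ)} {κ : ℝ}
    {Λ : ℕ → ℕ → ℝ} :
    NE9 (C := { C with
          Dom := C.Dom ⊕ (C.Dom × T)
          scale := Sum.elim C.scale fun p => C.scale p.1
          d := Sum.elim C.d fun p => C.d p.1
          d_nonneg := Sum.rec (fun X => C.d_nonneg X) fun p => C.d_nonneg p.1 })
        (fun g U X => Sum.elim (E g U) (fun p => D p.2 g U p.1) X) W κ Λ
      ↔ NE9 E W κ Λ ∧ ∀ t, NE9 (D t) W κ Λ := by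
  constructor
  · intro h
    exact ⟨fun g hg g' hg' U X => h g hg g' hg' U (Sum.inl X),
      fun t g hg g' hg' U X => h g hg g' hg' U (Sum.inr (X, t))⟩
  · rintro ⟨h0, h1⟩ g hg g' hg' U (X | ⟨X, t⟩)
    · exact h0 g hg g' hg' U X
    · exact h1 t g hg g' hg' U X

/-- The Lipschitz-in-the-background bracket on the dressed carriers ⇔ vacuum bracket ∧ `∀ t` dressed bracket, with the
SAME constant family `CU` (gauge unchanged). [cite: Balaban1988Convergent, (2.27)-(2.28) p.259] -/
theorem lipBackground_dressed_iff (E : Functional C C.BgA) (D : T → Functional C C.BgA) {W : Set (ℕ → ℝ)} {κ : ℝ}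
    {CU : (ℕ → ℝ) → ℕ → ℝ} :
    LipBackground (C := { C with
          Dom := C.Dom ⊕ (C.Dom × T)
          scale := Sum.elim C.scale fun p => C.scale p.1
          d := Sum.elim C.d fun p => C.d p.1
          d_nonneg := Sum.rec (fun X => C.d_nonneg X) fun p => C.d_nonneg p.1 })
        (fun g U X => Sum.elim (E g U) (fun p => D p.2 g U p.1) X) W κ CU
      ↔ LipBackground E W κ CU ∧ ∀ t, LipBackground (D t) W κ CU := by
  constructor
  · intro h
    exact ⟨fun g hg U U' X => h g hg U U' (Sum.inl X), fun t g hg U U' X => h g hg U U' (Sum.inr (X, t))⟩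
  · rintro ⟨h0, h1⟩ g hg U U' (X | ⟨X, t⟩)
    · exact h0 g hg U U' X
    · exact h1 t g hg U U' X

/-! ## §3 The prover's road and the two pull-backs -/

/-- **THE PROVER'S ROAD TO N18 ON THE DRESSED CARRIERS**: a vacuum rate `NE5 EA EB W κ θ C₀` and per-source dressed rates
`NE5 (DA t) (DB t) W κ θ (c t)` whose constants are BOUNDED on the window, `0 ≤ c t ≤ C₁`, give N18's decl on the dressed
carriers with the single constant `max C₀ C₁` (`0 ≤ θ`, `0 ≤ C₀`). [cite: Balaban1987RG1, Thm 1 p.259] -/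
theorem ne5_dressed_of_family (EA : Functional C C.BgA) (EB : Functional C C.BgB) (DA : T → Functional C C.BgA)
    (DB : T → Functional C C.BgB) {W : Set (ℕ → ℝ)} {κ θ C₀ C₁ : ℝ} {c : T → ℝ} (hθ : 0 ≤ θ) (hC₀ : 0 ≤ C₀)
    (h0 : NE5 EA EB W κ θ C₀) (hc : ∀ t, 0 ≤ c t ∧ c t ≤ C₁) (h1 : ∀ t, NE5 (DA t) (DB t) W κ θ (c t)) :
    NE5 (C := { C with
          Dom := C.Dom ⊕ (C.Dom × T)
          scale := Sum.elim C.scale fun p => C.scale p.1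
          d := Sum.elim C.d fun p => C.d p.1
          d_nonneg := Sum.rec (fun X => C.d_nonneg X) fun p => C.d_nonneg p.1 })
        (fun g U X => Sum.elim (EA g U) (fun p => DA p.2 g U p.1) X)
        (fun g U X => Sum.elim (EB g U) (fun p => DB p.2 g U p.1) X) W κ θ (max C₀ C₁) :=
  (ne5_dressed_iff EA EB DA DB).2
    ⟨ne5_mono h0 Set.Subset.rfl le_rfl hθ le_rfl hC₀ (le_max_left _ _),
      fun t => ne5_mono (h1 t) Set.Subset.rfl le_rfl hθ le_rfl (hc t).1 ((hc t).2.trans (le_max_right _ _))⟩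

/-- Pull-back to the vacuum indices (`N18Knit.ne5_comap` along `Sum.inl`): N18 on the dressed carriers gives the vacuum
N18 with the same letters. [cite: Balaban1987RG1, Thm 1 p.259] -/
theorem ne5_vacuum_of_dressed (EA : Functional C C.BgA) (EB : Functional C C.BgB) (DA : T → Functional C C.BgA)
    (DB : T → Functional C C.BgB) {W : Set (ℕ → ℝ)} {κ θ C₅ : ℝ}
    (h : NE5 (C := { C with
          Dom := C.Dom ⊕ (C.Dom × T)
          scale := Sum.elim C.scale fun p => C.scale p.1
          d := Sum.elim C.d fun p => C.d p.1
          d_nonneg := Sum.rec (fun X => C.d_nonneg X) fun p => C.d_nonneg p.1 })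
        (fun g U X => Sum.elim (EA g U) (fun p => DA p.2 g U p.1) X)
        (fun g U X => Sum.elim (EB g U) (fun p => DB p.2 g U p.1) X) W κ θ C₅) :
    NE5 EA EB W κ θ C₅ :=
  ((ne5_dressed_iff EA EB DA DB).1 h).1

/-- Pull-back to the source-`t` slice (`X ↦ Sum.inr (X, t)`): N18 on the dressed carriers gives, for every `t`, the dressed
two-run rate with the same letters. [cite: Balaban1988Convergent, (2.27) p.259] -/
theorem ne5_source_of_dressed (EA : Functional C C.BgA) (EB : Functional C C.BgB) (DA : T → Functional C C.BgA)
    (DB : T → Functional C C.BgB) {W : Set (ℕ → ℝ)} {κ θ C₅ : ℝ}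
    (h : NE5 (C := { C with
          Dom := C.Dom ⊕ (C.Dom × T)
          scale := Sum.elim C.scale fun p => C.scale p.1
          d := Sum.elim C.d fun p => C.d p.1
          d_nonneg := Sum.rec (fun X => C.d_nonneg X) fun p => C.d_nonneg p.1 })
        (fun g U X => Sum.elim (EA g U) (fun p => DA p.2 g U p.1) X)
        (fun g U X => Sum.elim (EB g U) (fun p => DB p.2 g U p.1) X) W κ θ C₅) (t : T) :
    NE5 (DA t) (DB t) W κ θ C₅ :=
  ((ne5_dressed_iff EA EB DA DB).1 h).2 t

end Summit.QuantumFields.YangMills.BalabanUVNodes.N18DressedCarriers
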